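import Summits.BirchSwinnertonDyer.BirchSwinnertonDyer.Theorems.KimAtThreeFineKatoSATPoints
import Summits.BirchSwinnertonDyer.Rank1Residual.Additive.LocalLogImageRat
import HarnessLib

/-!
# The points side of SAT₀ / Lemma L at `ℚ₃` IN THE CRUX'S CURRENCY: `W/ℚ` globally minimal,
# `Addv W 3`, `3 ∤ c₃`, `#{Q ∈ E(ℚ₃) : 3 • Q = 0} = 1` — the binders of
# `KimAtThreeKolyvagin.KatoKuriharaPortThreeShared` (stmt-BirchSwinnertonDyer-19560) verbatim
# (cell `bsd-addord`, seat kim3 gen 12; `--supports 19560`, helper)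

HONEST FRAMING. Thin wrappers of `Theorems/KimAtThreeFineKatoSATPoints` (this seat, p483588) for
the `ℚ`-curve: with `X := W.baseChange ℚ_[3]` (additive over `ℤ_[3]` by n1011's
`hasAdditiveReduction_baseChange_padic_of_addv`, `ℤ_[3]`-integral because `W` is globally
minimal), the Kato-stratum binders of crux 19560 give, for `log := LocalLog.padicLog X`:
`log(E₁(ℚ₃)) = 3ℤ₃`, `log(E₀(ℚ₃)) = log(E(ℚ₃)) = ℤ₃`, and SAT₀'s step (δ) — a point of `E₀(ℚ₃)`
whose logarithm lies in `3ℤ₃` lies in `E₁(ℚ₃)`.  These are the points-side inputs the future proof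
of the (P-EXP) rider clause (ii) (LEMMA SAT₀, kim3 memo KIM3-W2-C1-g11 §2.4) and of Lemma L (i)
consumes at `ℚ₃`; the Galois side (`exp*`, [BK90]) waits on `defn-BlochKatoDualExponential` and
the `K_w`-port (memo KIM3-W2-C1-SIZING-g12 §1/§3).  TOOL theorems only; no definition, no named
fact, no `sorry`; closes nothing; nothing booked.

References: [SilvermanAEC2009] IV.6.4, VII.2.1–2.2; [Kim2022StructureSelmer] §3.3 Lemma 3.11;
kim3 memos as above.
-/

noncomputable section

-- the cell's Theorems namespace `Summit.BirchSwinnertonDyer.BirchSwinnertonDyer.…` repeats the summit name by design (D-0017)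
set_option linter.dupNamespace false

open scoped Classical

namespace Summit.BirchSwinnertonDyer.BirchSwinnertonDyer.Theorems.KimAtThreeFineKatoSATPointsRat

open WeierstrassCurve
open Summit.BirchSwinnertonDyer.Rank1Residual.Additive.LocalLog
open Summit.BirchSwinnertonDyer.BirchSwinnertonDyer.Theorems.KimAtThreeFineKatoSATPoints
open Literature.NumberTheory.EllipticCurves Literature.NumberTheory.EllipticCurves.Rank1Residual

variable (W : WeierstrassCurve ℚ) [W.IsElliptic] [W.IsGloballyMinimal]

/-- **`log(E₁(ℚ₃)) = 3ℤ₃`** for the globally minimal `W/ℚ` (any reduction type at `3`): Lemma L (i),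
`log_ω E₁(ℚ₃) = 3ℤ₃`. [cite: SilvermanAEC2009, IV.6.4(b) with VII.2.2] -/
theorem map_padicLog_formalFiltration_zero_three :
    ((W.baseChange ℚ_[3]).formalFiltration 0).map (padicLog (W.baseChange ℚ_[3])) =
      (Submodule.span ℤ_[3] {(3 : ℚ_[3])}).toAddSubgroup := by
  have h := map_padicLog_formalFiltration_zero (W.baseChange ℚ_[3]) rfl
  rwa [Nat.cast_ofNat] at h

/-- **`log(E₀(ℚ₃)) = ℤ₃`** on the Kato stratum (`Addv W 3`, `3 ∤ c₃`, `E(ℚ₃)[3] = 0` in the crux's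
form `#{Q : 3 • Q = 0} = 1`): Lemma L (i) / SAT₀ (δ) input `log_ω E₀(ℚ₃) = ℤ₃`.
[cite: Kim2022StructureSelmer, Lemma 3.10 (PDF p. 17)] -/
theorem map_padicLog_goodReductionSubgroup_three (hadd : Addv W 3)
    (hc : ¬ 3 ∣ (W.baseChange ℚ_[3]).localTamagawaNumber ℤ_[3])
    (ht : Nat.card {Q : (W.baseChange ℚ_[3]).toAffine.Point // (3 : ℕ) • Q = 0} = 1) :
    ((W.baseChange ℚ_[3]).goodReductionSubgroup ℤ_[3]).map (padicLog (W.baseChange ℚ_[3])) =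
      (Submodule.span ℤ_[3] {(1 : ℚ_[3])}).toAddSubgroup := by
  haveI := hasAdditiveReduction_baseChange_padic_of_addv W 3 hadd
  exact map_padicLog_goodReductionSubgroup_eq_span_one (W.baseChange ℚ_[3]) hc
    (forall_p_nsmul_eq_zero_of_natCard_eq_one (W.baseChange ℚ_[3]) ht)

/-- **`log(E(ℚ₃)) = ℤ₃`** on the Kato stratum (n1011's range theorem at `t = 0`, crux binders).
[cite: Kim2022StructureSelmer, Lemma 3.10 (PDF p. 17)] -/
theorem range_padicLog_three (hadd : Addv W 3)
    (hc : ¬ 3 ∣ (W.baseChange ℚ_[3]).localTamagawaNumber ℤ_[3])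
    (ht : Nat.card {Q : (W.baseChange ℚ_[3]).toAffine.Point // (3 : ℕ) • Q = 0} = 1) :
    (padicLog (W.baseChange ℚ_[3])).range = (Submodule.span ℤ_[3] {(1 : ℚ_[3])}).toAddSubgroup := by
  haveI := hasAdditiveReduction_baseChange_padic_of_addv W 3 hadd
  exact range_padicLog_eq_span_one (W.baseChange ℚ_[3]) hc
    (forall_p_nsmul_eq_zero_of_natCard_eq_one (W.baseChange ℚ_[3]) ht)

/-- **SAT₀ step (δ) on the Kato stratum**: a point of `E₀(ℚ₃)` with `‖log_ω P‖ ≤ 3⁻¹` lies in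
`E₁(ℚ₃)` — the injectivity of `λ_{ℚ₃} : E₀(ℚ₃)/E₁(ℚ₃) → ℤ₃/3ℤ₃` (`Addv W 3` and
`E(ℚ₃)[3] = 0`; no hypothesis on `c₃`). [cite: Kim2022StructureSelmer, §3.3 (Lemma 3.11, first line)] -/
theorem mem_formalFiltration_zero_of_norm_padicLog_le_three (hadd : Addv W 3)
    (ht : Nat.card {Q : (W.baseChange ℚ_[3]).toAffine.Point // (3 : ℕ) • Q = 0} = 1)
    {P : (W.baseChange ℚ_[3]).toAffine.Point}
    (hP0 : P ∈ (W.baseChange ℚ_[3]).goodReductionSubgroup ℤ_[3])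
    (hlog : ‖padicLog (W.baseChange ℚ_[3]) P‖ ≤ (3 : ℝ)⁻¹) :
    P ∈ (W.baseChange ℚ_[3]).formalFiltration 0 := by
  haveI := hasAdditiveReduction_baseChange_padic_of_addv W 3 hadd
  refine mem_formalFiltration_zero_of_norm_padicLog_le (W.baseChange ℚ_[3]) rfl
    (forall_p_nsmul_eq_zero_of_natCard_eq_one (W.baseChange ℚ_[3]) ht) hP0 ?_
  rwa [Nat.cast_ofNat]

/-- **The trace-dual of `log_ω(E(ℚ₃))` is `ℤ₃`** on the Kato stratum: for `a ∈ ℚ₃`,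
`a · log P ∈ ℤ₃` for every `P ∈ E(ℚ₃)` iff `a ∈ ℤ₃` — the POINTS half of Lemma L (ii)
`exp*_ω(H¹(ℚ₃, T₃E)) = (log_ω E(ℚ₃))^∨ = ℤ₃`; the other half is [BK90] Prop. 3.8 with local Tate
duality in the lattice form `exp*_ω(H¹(ℚ₃,T)) = {a : ∀ P, a · log_ω P ∈ ℤ₃}` (sizing memo (S5)),
after which Lemma L (ii) on the stratum is this `iff` read right to left and left to right.
[cite: Kim2022StructureSelmer, Lemma 3.10 (PDF p. 17)] -/
theorem forall_norm_mul_padicLog_le_one_iff_three (hadd : Addv W 3)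
    (hc : ¬ 3 ∣ (W.baseChange ℚ_[3]).localTamagawaNumber ℤ_[3])
    (ht : Nat.card {Q : (W.baseChange ℚ_[3]).toAffine.Point // (3 : ℕ) • Q = 0} = 1) (a : ℚ_[3]) :
    (∀ P : (W.baseChange ℚ_[3]).toAffine.Point, ‖a * padicLog (W.baseChange ℚ_[3]) P‖ ≤ 1) ↔
      ‖a‖ ≤ 1 := by
  constructor
  · intro h
    have h1 : (1 : ℚ_[3]) ∈ (padicLog (W.baseChange ℚ_[3])).range := by
      rw [range_padicLog_three W hadd hc ht, Submodule.mem_toAddSubgroup]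
      exact Submodule.mem_span_singleton_self _
    obtain ⟨P, hP⟩ := h1
    have hP' := h P
    rwa [hP, mul_one] at hP'
  · intro ha P
    have hP : padicLog (W.baseChange ℚ_[3]) P ∈ (padicLog (W.baseChange ℚ_[3])).range := ⟨P, rfl⟩
    rw [range_padicLog_three W hadd hc ht, Submodule.mem_toAddSubgroup,
      Submodule.mem_span_singleton] at hP
    obtain ⟨c, hc'⟩ := hP
    rw [← hc', Algebra.smul_def, PadicInt.algebraMap_apply, mul_one, norm_mul]
    exact mul_le_one₀ ha (norm_nonneg _) (PadicInt.norm_le_one c)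

end Summit.BirchSwinnertonDyer.BirchSwinnertonDyer.Theorems.KimAtThreeFineKatoSATPointsRat

end
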